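import Mathlib
import Summits.ValiantsHypothesis.ValiantsHypothesis.Theorems.LacunarySymmetroidMatrixDescartesCensusTropicalKLaw
import Summits.ValiantsHypothesis.ValiantsHypothesis.Theorems.LacunarySymmetroidMatrixDescartesCensusTropicalKLawSlopes

/-!
# Route «KPlusLogSqLaw», crux `TropicalB` (stmt-ValiantsHypothesis-19771) — the ROW-COST RECURSION implies the tropical `K + log² m` law
# (indeed its quasi-polynomial `B⁺` shape): «one more slope class costs a factor `A·m` over the HALF-SIZE capacity plus the relabel budget»

HONEST FRAMING.  Helper file (cell `pub-symmetroid`, seat val-sym-trop-p1 g22, 2026-08-29) `--supports` the crux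
`Summit.ValiantsHypothesis.ValiantsHypothesis.Theses.KPlusLogSqLaw.TropicalB` (item `stmt-ValiantsHypothesis-19771`; in census currency
`TropicalCensus.TropKPlusLogSqLaw`, `Iff.rfl`-equal to the crux).  It proves an IMPLICATION whose hypothesis — the ROW-COST RECURSION `RC(A, B)`:

  `∀ m K b, TropRootLawAt (m / 2) K b → TropRootLawAt m (K + 1) (A·m·(b + 1) + B·m²·(K + 1))`

— is a CONJECTURE SHAPE of this seat (memo DUAL-LANE-g22 §2/§8), NOT asserted, NOT known, and NOT equivalent to the crux (it is stronger: it gives the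
`B⁺` shape below).  Nothing here bears on `TropicalB` in its window, `WeakLifting`, the doors, `MatrixDescartes` (stmt-ValiantsHypothesis-18050) or
VP ≠ VNP.  WHY THIS SHAPE (located reading, not claimed): every construction known to the cell pays rows per multiplying digit — SHIFT-THREE realises
`K : 2 → 3` as `T(m,3) ≈ m·T(m/2, 2)` (one rotation digit times a half-size relabel digit), path designs pay a factor `≥ 2` per digit (Gusfield, tree
`…TropicalBWalkGusfield`), and the additive `B·m²·(K+1)` is the relabel budget (tree `chain_le_permChanges_add`); a refutation of `TropicalB` is exactly a
family violating every `RC(A, B)` (unboundedly many permutation digits at additive row cost).  `RC` allows `T(m,K) ≈ A^K m^{K−1} / 2^{K²/2}` at fixed `K`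
(so it does not bet on the cell's fork «`T(m,4)` cubic?») and is consistent with the staircase and with every census row of the tree.

CONTENT.
* `tropRootLawAt_le_one` — `m ≤ 1 ⇒ TropRootLawAt m K K` (slope counting).
* `rowCost_arith` — the arithmetic step.
* `tropRootLawAt_of_rowCost` — **`RC(A,B) ⇒ ∀ m K, TropRootLawAt m K ((K+1)·W·(m+1)²·X^(⌊log₂ m⌋+1))`** with `W = 4(A+1)(B+1)`, `X = 4(A+1)(m+1)`:
  quasi-polynomial in `m`, LINEAR in `K` (induction on `K`, halving `m` at each step: depth `⌊log₂ m⌋ + 1`).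
* `tropKPlusLogSqLaw_of_rowCost` — **`RC(A,B) ⇒ TropKPlusLogSqLaw`** (with `C = W + 8(A+1) + 8`).
[this seat; bookkeeping in the style of the tree's `ClassAddition.tropKPlusLogSqLaw_of_classAddition`]
-/

set_option linter.dupNamespace false
set_option autoImplicit false

namespace Summit.ValiantsHypothesis.ValiantsHypothesis.Theorems.KPlusLogSqLaw

open Summit.ValiantsHypothesis.ValiantsHypothesis.Theorems.LacunarySymmetroidMatrixDescartes.TropicalCensus

namespace RowCost

/-- tiny sizes: `m ≤ 1 ⇒ T(m,K) ≤ K` (indeed `K − 1` at `m = 1`, `0` at `m = 0`), by slope counting. [folklore] -/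
theorem tropRootLawAt_le_one {m : ℕ} (hm : m ≤ 1) (K : ℕ) : TropRootLawAt m K K := by
  refine tropRootLawAt_mono ?_ (tropRootLawAt_choose m K)
  interval_cases m
  · simp
  · rcases Nat.eq_zero_or_pos K with rfl | hK
    · simp
    · rw [show K + 1 - 1 = K from by omega, Nat.choose_one_right]; omega

/-- the arithmetic of one halving step. -/
theorem rowCost_arith (A B K m Q X : ℕ) (hX : X = 4 * (A + 1) * (m + 1)) (hQ : (K + 1) * (B + 1) * (m + 1) ^ 2 ≤ Q) :
    A * m * (Q + 1) + B * m ^ 2 * (K + 1) ≤ Q * X := by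
  have hpos : 0 < (K + 1) * (B + 1) * (m + 1) ^ 2 := by positivity
  have hQ1 : 1 ≤ Q := le_trans hpos hQ
  have h1 : A * m * (Q + 1) ≤ 4 * A * m * Q := by nlinarith [Nat.zero_le (A * m)]
  have h2 : B * m ^ 2 * (K + 1) ≤ Q := by
    calc B * m ^ 2 * (K + 1) = (K + 1) * B * m ^ 2 := by ring
      _ ≤ (K + 1) * (B + 1) * (m + 1) ^ 2 :=
          Nat.mul_le_mul (Nat.mul_le_mul le_rfl (Nat.le_succ B)) (Nat.pow_le_pow_left (Nat.le_succ m) 2)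
      _ ≤ Q := hQ
  have h3 : 4 * A * m * Q + Q ≤ Q * X := by
    rw [hX]; nlinarith [Nat.zero_le A, Nat.zero_le m, hQ1]
  omega

/-- **THE ROW-COST RECURSION GIVES A QUASI-POLYNOMIAL ROW.**  If `RC(A, B)` holds then for all `m, K`:
`TropRootLawAt m K ((K+1)·W·(m+1)²·X^(⌊log₂ m⌋ + 1))`, `W = 4(A+1)(B+1)`, `X = 4(A+1)(m+1)`. [this seat] -/
theorem tropRootLawAt_of_rowCost (A B : ℕ)
    (hRC : ∀ m K b : ℕ, TropRootLawAt (m / 2) K b → TropRootLawAt m (K + 1) (A * m * (b + 1) + B * m ^ 2 * (K + 1))) :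
    ∀ K m : ℕ, TropRootLawAt m K ((K + 1) * (4 * (A + 1) * (B + 1)) * (m + 1) ^ 2 * (4 * (A + 1) * (m + 1)) ^ (Nat.log 2 m + 1)) := by
  intro K
  induction K with
  | zero => intro m; exact tropRootLawAt_zero m _
  | succ K ih =>
    intro m
    -- the target bound dominates `K + 1` (all factors ≥ 1), which settles the tiny sizes
    have hW1 : 1 ≤ 4 * (A + 1) * (B + 1) := by nlinarith [Nat.zero_le A, Nat.zero_le B]
    have hX1 : 1 ≤ 4 * (A + 1) * (m + 1) := by nlinarith [Nat.zero_le A, Nat.zero_le m]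
    have hbig : K + 1 ≤ (K + 1 + 1) * (4 * (A + 1) * (B + 1)) * (m + 1) ^ 2 * (4 * (A + 1) * (m + 1)) ^ (Nat.log 2 m + 1) := by
      have h1 : 1 ≤ (m + 1) ^ 2 := Nat.one_le_pow _ _ (by omega)
      have h2 : 1 ≤ (4 * (A + 1) * (m + 1)) ^ (Nat.log 2 m + 1) := Nat.one_le_pow _ _ hX1
      calc K + 1 ≤ (K + 1 + 1) * 1 * 1 * 1 := by omega
        _ ≤ (K + 1 + 1) * (4 * (A + 1) * (B + 1)) * (m + 1) ^ 2 * (4 * (A + 1) * (m + 1)) ^ (Nat.log 2 m + 1) :=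
          Nat.mul_le_mul (Nat.mul_le_mul (Nat.mul_le_mul le_rfl hW1) h1) h2
    by_cases hm : m ≤ 1
    · exact tropRootLawAt_mono hbig (tropRootLawAt_le_one hm (K + 1))
    · push Not at hm
      -- halving: `⌊log₂ (m/2)⌋ + 1 = ⌊log₂ m⌋`
      set L := Nat.log 2 m with hL
      have hL1 : 1 ≤ L := by
        rw [hL]; exact Nat.le_log_of_pow_le (by norm_num) (by omega)
      have hLh : Nat.log 2 (m / 2) + 1 = L := by
        rw [Nat.log_div_base, hL]; omega
      -- the half-size row from the induction hypothesis, fed to the recursion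
      have h := hRC m K _ (ih (m / 2))
      refine tropRootLawAt_mono ?_ h
      -- compare the bounds
      set X := 4 * (A + 1) * (m + 1) with hXdef
      set W := 4 * (A + 1) * (B + 1) with hWdef
      set Q := (K + 1) * W * (m + 1) ^ 2 * X ^ L with hQdef
      have hXh : 4 * (A + 1) * (m / 2 + 1) ≤ X := by rw [hXdef]; exact Nat.mul_le_mul_left _ (by omega)
      have hmh : (m / 2 + 1) ^ 2 ≤ (m + 1) ^ 2 := Nat.pow_le_pow_left (by omega) 2
      have hpow : (4 * (A + 1) * (m / 2 + 1)) ^ (Nat.log 2 (m / 2) + 1) ≤ X ^ L := by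
        rw [hLh]; exact Nat.pow_le_pow_left hXh L
      have hβ : (K + 1) * W * (m / 2 + 1) ^ 2 * (4 * (A + 1) * (m / 2 + 1)) ^ (Nat.log 2 (m / 2) + 1) ≤ Q := by
        rw [hQdef]; exact Nat.mul_le_mul (Nat.mul_le_mul le_rfl hmh) hpow
      have hQlow : (K + 1) * (B + 1) * (m + 1) ^ 2 ≤ Q := by
        rw [hQdef]
        have hXL : 1 ≤ X ^ L := Nat.one_le_pow _ _ hX1
        have hWB : B + 1 ≤ W := by rw [hWdef]; nlinarith [Nat.zero_le A, Nat.zero_le B]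
        calc (K + 1) * (B + 1) * (m + 1) ^ 2 = (K + 1) * (B + 1) * (m + 1) ^ 2 * 1 := by ring
          _ ≤ (K + 1) * W * (m + 1) ^ 2 * X ^ L := Nat.mul_le_mul (Nat.mul_le_mul (Nat.mul_le_mul le_rfl hWB) le_rfl) hXL
      have harith := rowCost_arith A B K m Q X hXdef hQlow
      calc A * m * ((K + 1) * W * (m / 2 + 1) ^ 2 * (4 * (A + 1) * (m / 2 + 1)) ^ (Nat.log 2 (m / 2) + 1) + 1) + B * m ^ 2 * (K + 1)
          ≤ A * m * (Q + 1) + B * m ^ 2 * (K + 1) := by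
            have := Nat.mul_le_mul_left (A * m) (Nat.add_le_add_right hβ 1); omega
        _ ≤ Q * X := harith
        _ = (K + 1) * W * (m + 1) ^ 2 * X ^ (L + 1) := by rw [hQdef, pow_succ]; ring
        _ ≤ (K + 1 + 1) * W * (m + 1) ^ 2 * X ^ (L + 1) :=
          Nat.mul_le_mul (Nat.mul_le_mul (Nat.mul_le_mul (by omega) le_rfl) le_rfl) le_rfl

/-- exponent bookkeeping: the quasi-polynomial row is inside `2^(C (K + ⌊log₂ m⌋²))` for `K ≥ 1`, `C = W + 8(A+1) + 8`. -/
theorem bound_le_two_pow (A B K m : ℕ) (hK : 1 ≤ K) :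
    (K + 1) * (4 * (A + 1) * (B + 1)) * (m + 1) ^ 2 * (4 * (A + 1) * (m + 1)) ^ (Nat.log 2 m + 1) ≤
      2 ^ ((4 * (A + 1) * (B + 1) + 8 * (A + 1) + 8) * (K + Nat.log 2 m ^ 2)) := by
  set L := Nat.log 2 m with hL
  set a := 4 * (A + 1) with ha
  set W := 4 * (A + 1) * (B + 1) with hW
  have hm : m + 1 ≤ 2 ^ (L + 1) := by
    have : m < 2 ^ (L + 1) := hL ▸ Nat.lt_pow_succ_log_self (by norm_num) m
    omega
  have hK2 : K + 1 ≤ 2 ^ K := Nat.lt_two_pow_self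
  have hW2 : W ≤ 2 ^ W := Nat.lt_two_pow_self.le
  have ha2 : a ≤ 2 ^ a := Nat.lt_two_pow_self.le
  have hX : a * (m + 1) ≤ 2 ^ (a + (L + 1)) := by rw [pow_add]; exact Nat.mul_le_mul ha2 hm
  have hm2 : (m + 1) ^ 2 ≤ 2 ^ (2 * (L + 1)) := by
    rw [pow_mul']
    exact Nat.pow_le_pow_left hm 2
  have hXp : (a * (m + 1)) ^ (L + 1) ≤ 2 ^ ((a + (L + 1)) * (L + 1)) := by
    rw [pow_mul]; exact Nat.pow_le_pow_left hX _
  have hWa : W = a * (B + 1) := by rw [hW, ha]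
  calc (K + 1) * W * (m + 1) ^ 2 * (a * (m + 1)) ^ (L + 1)
      ≤ 2 ^ K * 2 ^ W * 2 ^ (2 * (L + 1)) * 2 ^ ((a + (L + 1)) * (L + 1)) :=
        Nat.mul_le_mul (Nat.mul_le_mul (Nat.mul_le_mul hK2 hW2) hm2) hXp
    _ = 2 ^ (K + W + 2 * (L + 1) + (a + (L + 1)) * (L + 1)) := by rw [← pow_add, ← pow_add, ← pow_add]
    _ ≤ 2 ^ ((W + 8 * (A + 1) + 8) * (K + L ^ 2)) := by
        apply Nat.pow_le_pow_right (by norm_num)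
        rcases Nat.eq_zero_or_pos L with hL0 | hLpos
        · rw [hL0]; nlinarith [hK, Nat.zero_le W, Nat.zero_le A]
        · have hLL : L ≤ L ^ 2 := Nat.le_self_pow two_ne_zero L
          nlinarith [hK, hLL, Nat.zero_le W, Nat.zero_le A, Nat.zero_le K]

/-- **THE ROW-COST RECURSION IMPLIES THE TROPICAL `K + log² m` LAW** (`TropKPlusLogSqLaw`, `Iff.rfl`-equal to the crux `TropicalB`), with the
constant `C = 4(A+1)(B+1) + 8(A+1) + 8`. [this seat] -/
theorem tropKPlusLogSqLaw_of_rowCost (A B : ℕ)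
    (hRC : ∀ m K b : ℕ, TropRootLawAt (m / 2) K b → TropRootLawAt m (K + 1) (A * m * (b + 1) + B * m ^ 2 * (K + 1))) :
    TropKPlusLogSqLaw := by
  refine ⟨4 * (A + 1) * (B + 1) + 8 * (A + 1) + 8, fun m K => ?_⟩
  rcases Nat.eq_zero_or_pos K with rfl | hK
  · exact tropRootLawAt_zero m _
  · exact tropRootLawAt_mono (bound_le_two_pow A B K m hK) (tropRootLawAt_of_rowCost A B hRC K m)

end RowCost

end Summit.ValiantsHypothesis.ValiantsHypothesis.Theorems.KPlusLogSqLaw
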